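import Mathlib.LinearAlgebra.Lagrange
import Mathlib.LinearAlgebra.Vandermonde
import Mathlib.Data.Real.Basic
import Mathlib.Algebra.Order.BigOperators.Ring.Finset
import Mathlib.Analysis.SpecialFunctions.Pow.Real
import HarnessLib

/-!
# Zero-noise (Richardson) extrapolation: the coefficients, the linear system they solve, the
  cancellation of the noise expansion, and the error-amplification constant `Γₙ`

Topic `Literature/Computability/QuantumComplexity` (pub-qadeq lane, CLAIMS rows E-17 / E-21 /
E-22 / E-37 / E-44 / E-47: every "utility"-type dynamics claim reports an ERROR-MITIGATED
expectation value, and the mitigation named most often is zero-noise extrapolation — IBM's utility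
experiment [KimEtAl2023, p. 2]: "We therefore turn to zero-noise extrapolation (ZNE), which provides
a biased estimator at a potentially much lower sampling cost. ZNE is either a polynomial or
exponential extrapolation method for noisy expectation values as a function of a noise parameter.
This requires the controlled amplification of the intrinsic hardware noise by a known gain factor
`G` to extrapolate to the ideal `G = 0` result.").

HONEST FRAMING: instance-level adjudication of specific advantage claims; no claim about BQP vs BPP
or the summit. Nothing in this file says that any device's expectation values HAVE a polynomial (or
any other) dependence on the amplification factor; the file fixes the ARITHMETIC of the polynomial
(Richardson) estimator as printed — what it cancels when the expansion holds, and by how much it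
amplifies the statistical error — so that a lane report can name the assumption and the constant.

## Sources (verbatim)

[TemmeBravyiGambetta2017] K. Temme, S. Bravyi, J. M. Gambetta, *Error mitigation for short-depth
quantum circuits*, PRL 119, 180509 (2017) = arXiv:1612.02058 (tex chunks p0003, p0011 of
`lit read arxiv:1612.02058`). Main text: the noisy expectation value expands as
"`E_K(λ) = E* + Σ_{k=1}^n a_k λ^k + R_{n+1}(λ, ℒ, T)`"; "let us assume we can run the quantum circuit
at different noise rates `λ_j`, with `j = 0,…,n` and obtain experimental estimates
`Ê_K(λ_j) = E_K(λ_j) + δ_j`. Here the `λ_j = c_j λ` are appropriately rescaled values of the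
experimental noise rate `λ` … The estimate of `E*` can be significantly improved by considering the
approximation `Ê^n_K(λ)`, which is written as the linear combination `Ê^n_K(λ) = Σ_{j=0}^n γ_j Ê_K(c_j λ)`.
Here we require the coefficients `γ_j` to satisfy the linear system of equations
`Σ_{j=0}^n γ_j = 1` and `Σ_{j=0}^n γ_j c_j^k = 0` for `k = 1 … n`. The linear combination … will be an
approximation to `E*` up to an error of order `O(λ^{n+1})`." … "the error between the exact
expectation value `E*` and the estimator `Ê^n_K(λ)` can be bounded by
`|E* − Ê^n_K(λ)| ≤ Γ_n (δ* + ‖A‖ l_{n+1} (λT)^{n+1}/(n+1)!)`. Here `Γ_n = Σ_{j=0}^n |γ_j| c_j^{n+1}` and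
`δ* = max_j |δ_j|` is the largest experimental error." SM §III: "`Ê^n_K(λ) = E* (Σ_j γ_j) +
Σ_{k=1}^n a_k λ^k (Σ_j γ_j c_j^k) + (Σ_j γ_j R(c_j λ, ℒ, T) + δ_j)`" and "after the application of the
triangle inequality `|E* − Ê^n_K(λ)| ≤ Σ_{j=0}^n |γ_j| (|R(c_j λ, ℒ, T)| + |δ_j|)`. After the application
of the bound `|R(c_j λ, ℒ, T)| ≤ ‖A‖ l_{n+1} c_j^{n+1} λ^{n+1} T^{n+1} ((n+1)!)^{-1}` and the observation
that `c_j ≥ 1`, we can bound the difference with `Γ_n`".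

[MohammadipourLi2025] P. Mohammadipour, X. Li, *Direct analysis of zero-noise extrapolation*, Quantum
9, 1909 (2025) = arXiv:2502.20673, §2 (chunk p0005): "`p_n(0) = Σ_{j=0}^n f(x_j) γ_j`, where
`γ_j := L_j(0) = ∏_{k=0, k≠j}^n x_k/(x_k − x_j)`. The above definition is equivalent to the condition
`Σ_{k=0}^n γ_k x_k^r = δ_{r,0}`, `r = 0, 1, …, n`."; §2 (chunk p0006): "`Var[p_n(0)] = Σ_j γ_j² Var[f̂(x_j)]
… ≤ (σ²/N_S) Σ_j γ_j² ≤ (σ²/N_S) (Σ_j |γ_j|)²`".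

## Contents (all proved, 0 named facts)

* `richardsonCoeff c j = ∏_{m ≠ j} c_m / (c_m − c_j)` for nodes `c : Fin (n+1) → F` over any field —
  the Lagrange basis value `L_j(0)` (`richardsonCoeff_eq_eval_basis`) [MohammadipourLi2025, §2].
* `sum_richardsonCoeff_mul_eval`: EXACTNESS on polynomials of degree `≤ n`,
  `Σ_j γ_j p(c_j) = p(0)`; hence THE PRINTED LINEAR SYSTEM `sum_richardsonCoeff` (`Σ_j γ_j = 1`) and
  `sum_richardsonCoeff_mul_pow` (`Σ_j γ_j c_j^k = 0`, `1 ≤ k ≤ n`) [TemmeBravyiGambetta2017, eq.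
  (RichardsonEqn)], the `δ_{r,0}` form `sum_richardsonCoeff_mul_pow_eq_ite`, and UNIQUENESS
  `eq_richardsonCoeff_of_moments` (distinct nodes: the system determines `γ`, by the Vandermonde
  determinant) — the "equivalent to the condition" of [MohammadipourLi2025, §2].
* `estimate c Ê = Σ_j γ_j Ê_j` and the CANCELLATION `estimate_eq_of_expansion`: if
  `Ê_j = E* + Σ_{k=1}^n a_k (c_j λ)^k + R_j + δ_j` then `Ê^n = E* + Σ_j γ_j (R_j + δ_j)`
  [TemmeBravyiGambetta2017, SM §III display]; over `ℝ`, the triangle-inequality bound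
  `abs_estimate_sub_le` and the printed final bound `abs_estimate_sub_le_gammaConst`:
  `|E* − Ê^n| ≤ Γ_n (δ* + B)` whenever `|R_j| ≤ B c_j^{n+1}`, `|δ_j| ≤ δ*`, `1 ≤ c_j`, with
  `gammaConst c = Γ_n = Σ_j |γ_j| c_j^{n+1}` [TemmeBravyiGambetta2017, eq. (bound)].
* `sum_sq_richardsonCoeff_le`: `Σ_j γ_j² ≤ (Σ_j |γ_j|)²`, the shot-noise amplification factor
  [MohammadipourLi2025, §2 (variance display)].
* The two-point (linear, `n = 1`) case used as "ZNE (linear)" in [KimEtAl2023, Fig. 2]: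
  `richardsonCoeff_fin_two` and `estimate_fin_two` (`Ê¹ = (c₁ Ê₀ − c₀ Ê₁)/(c₁ − c₀)`).
* Two noise levels `ε₀`, `rε₀` [EndoBenjaminLi2018, §XI]: the printed LINEAR formula
  `⟨Z⟩(0) = (r⟨Z⟩(ε₀) − ⟨Z⟩(rε₀))/(r − 1)` is the `n = 1` Richardson estimate with nodes `(1, r)`
  (`estimate_pair_one`); the printed EXPONENTIAL formula `expEstimate r Z₀ Z_r = Z₀^{r/(r−1)} Z_r^{1/(1−r)}`
  is exact on every response `A·e^{−bε}`, `A > 0` (`expEstimate_exact`) and is the linear formula applied to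
  `log ⟨Z⟩` (`log_expEstimate`) — the "ZNE (exp)" / "ZNE (linear)" pair of [KimEtAl2023, Fig. 2].
* A located discrepancy, recorded not repaired: the main text of arXiv:1612.02058 prints the closed
  form "`γ_j = ∏_{m≠j} c_m (c_j − c_m)^{-1}`" (chunk p0003 L33); `prod_printed_eq_neg_one_pow_mul`
  shows this equals `(−1)^n γ_j`, so it solves the printed system iff `n` is even, and
  `printed_closed_form_fin_two` exhibits `n = 1`, `c = (1, 2)`, where it sums to `−1`. The linear
  system, the protocol and the error bound of the paper are unaffected; the Lagrange form above is
  the one printed in [MohammadipourLi2025, §2].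

[EndoBenjaminLi2018] S. Endo, S. C. Benjamin, Y. Li, *Practical quantum error mitigation for near-future
applications*, PRX 8, 031027 (2018) = arXiv:1712.09271, §XI (pp. 9–11 of the arXiv PDF): "We obtain the
expected value `⟨Z⟩(ε₀)` with the lowest attainable error rate `ε₀`, and by increasing error rate to `rε₀`
with `r > 1`, we obtain another expected value `⟨Z⟩(rε₀)`. Using these two values, we can infer
`⟨Z⟩(0) = (r⟨Z⟩(ε₀) − ⟨Z⟩(rε₀))/(r − 1)`" (p. 9) … "the experimentalist indeed assumes that the expected
value `⟨Z⟩(ε)` changes exponentially with respect to the error rate `ε` and converges to 0 in the limit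
of `ε → ∞`. Then she will infer the error-free value as `⟨Z⟩(0) = ⟨Z⟩(ε₀)^{r/(r−1)} ⟨Z⟩(rε₀)^{1/(1−r)}`"
(pp. 10–11).

Not formalised: the Born-series origin of the expansion `E_K(λ) = E* + Σ a_k λ^k + R` and the bound
on `R` (physics input, here a hypothesis), the time-rescaling protocol `J → c⁻¹J(c⁻¹t)`, the
`e^{−Nε}` heuristic behind the exponential ansatz [EndoBenjaminLi2018, §XII], multi-parameter
exponential fits, and the quasi-probability (PEC) method of [TemmeBravyiGambetta2017].
-/

noncomputable section

open Finset Polynomial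

namespace Literature.Computability.QuantumComplexity

namespace ZNE

variable {F : Type*} [Field F] {n : ℕ}

/-! ### The coefficients -/

/-- The Richardson / Lagrange extrapolation coefficient of node `j` among the `n + 1` noise
amplification factors `c₀, …, cₙ`: `γ_j = ∏_{m ≠ j} c_m / (c_m − c_j)`.
[cite: MohammadipourLi2025, §2 (display defining γ_j := L_j(0))] -/
def richardsonCoeff (c : Fin (n + 1) → F) (j : Fin (n + 1)) : F :=
  ∏ m ∈ univ.erase j, c m / (c m - c j)

/-- `γ_j = L_j(0)`, the `j`-th Lagrange basis polynomial of the nodes evaluated at zero noise.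
[cite: MohammadipourLi2025, §2 ("γ_j := L_j(0)")] -/
theorem richardsonCoeff_eq_eval_basis (c : Fin (n + 1) → F) (j : Fin (n + 1)) :
    richardsonCoeff c j = (Lagrange.basis univ c j).eval 0 := by
  rw [richardsonCoeff, Lagrange.basis, eval_prod]
  refine prod_congr rfl fun m _ => ?_
  rw [Lagrange.basisDivisor, eval_mul, eval_C, eval_sub, eval_X, eval_C, zero_sub, ← neg_sub (c m) (c j),
    inv_neg]
  ring

/-- **Exactness on polynomials of degree at most `n`** (distinct nodes): `Σ_j γ_j p(c_j) = p(0)` —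
Richardson extrapolation of `n + 1` samples of a degree-`≤ n` polynomial response returns its
zero-noise value exactly. [cite: MohammadipourLi2025, §2 (p_n interpolates f; p_n(0) = Σ_j f(x_j) γ_j)] -/
theorem sum_richardsonCoeff_mul_eval {c : Fin (n + 1) → F} (hc : Function.Injective c) {p : F[X]}
    (hp : p.degree < (n + 1 : ℕ)) : ∑ j, richardsonCoeff c j * p.eval (c j) = p.eval 0 := by
  have hvs : Set.InjOn c (univ : Finset (Fin (n + 1))) := hc.injOn
  have hdeg : p.degree < #(univ : Finset (Fin (n + 1))) := by rwa [card_univ, Fintype.card_fin]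
  have hint := Lagrange.eq_interpolate hvs hdeg
  conv_rhs => rw [hint]
  rw [Lagrange.interpolate_apply, eval_finsetSum]
  refine sum_congr rfl fun j _ => ?_
  rw [eval_mul, eval_C, richardsonCoeff_eq_eval_basis, mul_comm]

/-- **The printed linear system, first equation**: `Σ_{j=0}^n γ_j = 1` (distinct nodes).
[cite: TemmeBravyiGambetta2017, eq. (RichardsonEqn) ("Σ_l γ_j = 1")] -/
theorem sum_richardsonCoeff {c : Fin (n + 1) → F} (hc : Function.Injective c) :
    ∑ j, richardsonCoeff c j = 1 := by
  have h := sum_richardsonCoeff_mul_eval hc (p := 1) (by rw [degree_one]; exact_mod_cast Nat.succ_pos n)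
  simpa using h

/-- **The printed linear system, moment equations**: `Σ_{j=0}^n γ_j c_j^k = 0` for `k = 1 … n`
(distinct nodes). [cite: TemmeBravyiGambetta2017, eq. (RichardsonEqn) ("Σ_j γ_j c_j^k = 0 for k = 1…n")] -/
theorem sum_richardsonCoeff_mul_pow {c : Fin (n + 1) → F} (hc : Function.Injective c) {k : ℕ}
    (hk1 : 1 ≤ k) (hkn : k ≤ n) : ∑ j, richardsonCoeff c j * c j ^ k = 0 := by
  have h := sum_richardsonCoeff_mul_eval hc (p := X ^ k)
    (by rw [degree_X_pow]; exact_mod_cast Nat.lt_succ_of_le hkn)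
  simpa [eval_pow, eval_X, zero_pow (by omega : k ≠ 0)] using h

/-- The `δ_{r,0}` form: `Σ_k γ_k c_k^r = δ_{r,0}` for `r = 0, 1, …, n`.
[cite: MohammadipourLi2025, §2 ("equivalent to the condition Σ_k γ_k x_k^r = δ_{r,0}, r = 0,1,…,n")] -/
theorem sum_richardsonCoeff_mul_pow_eq_ite {c : Fin (n + 1) → F} (hc : Function.Injective c) {r : ℕ}
    (hr : r ≤ n) : ∑ j, richardsonCoeff c j * c j ^ r = if r = 0 then 1 else 0 := by
  split_ifs with h
  · simpa [h] using sum_richardsonCoeff hc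
  · exact sum_richardsonCoeff_mul_pow hc (Nat.one_le_iff_ne_zero.2 h) hr

/-- **Uniqueness**: for distinct nodes the printed linear system DETERMINES the coefficients — any
`γ'` with `Σ_j γ'_j = 1` and `Σ_j γ'_j c_j^k = 0` (`1 ≤ k ≤ n`) is `richardsonCoeff c` (the
`(n+1) × (n+1)` Vandermonde matrix of distinct nodes is invertible).
[cite: MohammadipourLi2025, §2 ("The above definition is equivalent to the condition …")]
[cite: TemmeBravyiGambetta2017, main text ("The equations (RichardsonEqn) can be solved")] -/
theorem eq_richardsonCoeff_of_moments {c : Fin (n + 1) → F} (hc : Function.Injective c)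
    {γ' : Fin (n + 1) → F} (h0 : ∑ j, γ' j = 1)
    (hk : ∀ k : ℕ, 1 ≤ k → k ≤ n → ∑ j, γ' j * c j ^ k = 0) : γ' = richardsonCoeff c := by
  have hδ : (fun j => γ' j - richardsonCoeff c j) = 0 := by
    refine Matrix.eq_zero_of_forall_pow_sum_mul_pow_eq_zero hc fun i => ?_
    have hi : (i : ℕ) ≤ n := Nat.lt_succ_iff.1 i.2
    simp only [sub_mul, sum_sub_distrib]
    rcases Nat.eq_zero_or_pos (i : ℕ) with h | h
    · rw [h]
      simp only [pow_zero, mul_one, h0, sum_richardsonCoeff hc, sub_self]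
    · rw [hk i h hi, sum_richardsonCoeff_mul_pow hc h hi, sub_self]
  funext j
  exact sub_eq_zero.1 (congr_fun hδ j)

/-! ### The estimator and the cancellation of the noise expansion -/

/-- The Richardson zero-noise estimate `Ê^n = Σ_{j=0}^n γ_j Ê_j` built from the `n + 1` measured values
`Ê_j = Ê_K(c_j λ)` at the amplified noise levels. [cite: TemmeBravyiGambetta2017, eq. (RichardsonCoeff)] -/
def estimate (c Ehat : Fin (n + 1) → F) : F :=
  ∑ j, richardsonCoeff c j * Ehat j

/-- Unfolding of `estimate`. [cite: TemmeBravyiGambetta2017, eq. (RichardsonCoeff)] -/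
theorem estimate_eq (c Ehat : Fin (n + 1) → F) : estimate c Ehat = ∑ j, richardsonCoeff c j * Ehat j :=
  rfl

/-- **Cancellation** (SM §III): if each measured value carries the noise expansion
`Ê_j = E* + Σ_{k=1}^n a_k (c_j λ)^k + R_j + δ_j` (remainder `R_j = R(c_j λ, ℒ, T)`, experimental
error `δ_j`), then the orders `λ¹ … λⁿ` cancel exactly:
`Ê^n = E* (Σ_j γ_j) + Σ_k a_k λ^k (Σ_j γ_j c_j^k) + Σ_j γ_j (R_j + δ_j) = E* + Σ_j γ_j (R_j + δ_j)`.
[cite: TemmeBravyiGambetta2017, SM §III (display expanding Ê^n_K(λ))] -/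
theorem estimate_eq_of_expansion {c : Fin (n + 1) → F} (hc : Function.Injective c) (Estar lam : F)
    (a : ℕ → F) (R δ Ehat : Fin (n + 1) → F)
    (hE : ∀ j, Ehat j = Estar + ∑ k ∈ Icc 1 n, a k * (c j * lam) ^ k + R j + δ j) :
    estimate c Ehat = Estar + ∑ j, richardsonCoeff c j * (R j + δ j) := by
  have hmid : ∑ j, richardsonCoeff c j * ∑ k ∈ Icc 1 n, a k * (c j * lam) ^ k = 0 := by
    calc ∑ j, richardsonCoeff c j * ∑ k ∈ Icc 1 n, a k * (c j * lam) ^ k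
        = ∑ k ∈ Icc 1 n, a k * lam ^ k * ∑ j, richardsonCoeff c j * c j ^ k := by
          simp only [mul_sum]
          rw [sum_comm]
          exact sum_congr rfl fun k _ => sum_congr rfl fun j _ => by ring
      _ = 0 := sum_eq_zero fun k hk => by
          rw [sum_richardsonCoeff_mul_pow hc (mem_Icc.1 hk).1 (mem_Icc.1 hk).2, mul_zero]
  simp only [estimate, hE, mul_add, sum_add_distrib, ← sum_mul, sum_richardsonCoeff hc, one_mul, hmid,
    add_zero]
  ring

/-! ### Error bounds over `ℝ` -/

/-- The error-amplification constant `Γ_n = Σ_{j=0}^n |γ_j| c_j^{n+1}`.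
[cite: TemmeBravyiGambetta2017, main text (definition of Γ_n after eq. (bound))] -/
def gammaConst (c : Fin (n + 1) → ℝ) : ℝ :=
  ∑ j, |richardsonCoeff c j| * c j ^ (n + 1)

/-- **Triangle-inequality bound** (SM §III): under the expansion hypothesis of
`estimate_eq_of_expansion`, `|E* − Ê^n| ≤ Σ_j |γ_j| (|R_j| + |δ_j|)`.
[cite: TemmeBravyiGambetta2017, SM §III ("|E* − Ê^n_K(λ)| ≤ Σ_j |γ_j| (|R(c_jλ,ℒ,T)| + |δ_j|)")] -/
theorem abs_estimate_sub_le {c : Fin (n + 1) → ℝ} (hc : Function.Injective c) (Estar lam : ℝ)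
    (a : ℕ → ℝ) (R δ Ehat : Fin (n + 1) → ℝ)
    (hE : ∀ j, Ehat j = Estar + ∑ k ∈ Icc 1 n, a k * (c j * lam) ^ k + R j + δ j) :
    |Estar - estimate c Ehat| ≤ ∑ j, |richardsonCoeff c j| * (|R j| + |δ j|) := by
  rw [estimate_eq_of_expansion hc Estar lam a R δ Ehat hE, sub_add_cancel_left, abs_neg]
  refine (abs_sum_le_sum_abs _ _).trans (sum_le_sum fun j _ => ?_)
  rw [abs_mul]
  exact mul_le_mul_of_nonneg_left (abs_add_le _ _) (abs_nonneg _)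

/-- **The printed error bound**: if moreover `|R_j| ≤ B · c_j^{n+1}` (the remainder bound
`‖A‖ l_{n+1} c_j^{n+1} λ^{n+1} T^{n+1}/(n+1)!` with `B` the `c_j`-free part), `|δ_j| ≤ δ*` and `c_j ≥ 1`,
then `|E* − Ê^n| ≤ Γ_n (δ* + B)`.
[cite: TemmeBravyiGambetta2017, eq. (bound) ("|E* − Ê^n_K(λ)| ≤ Γ_n (δ* + ‖A‖ l_{n+1}(λT)^{n+1}/(n+1)!)")] -/
theorem abs_estimate_sub_le_gammaConst {c : Fin (n + 1) → ℝ} (hc : Function.Injective c)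
    (Estar lam : ℝ) (a : ℕ → ℝ) (R δ Ehat : Fin (n + 1) → ℝ)
    (hE : ∀ j, Ehat j = Estar + ∑ k ∈ Icc 1 n, a k * (c j * lam) ^ k + R j + δ j)
    {B δstar : ℝ} (hδstar : 0 ≤ δstar) (hc1 : ∀ j, 1 ≤ c j)
    (hR : ∀ j, |R j| ≤ B * c j ^ (n + 1)) (hδ : ∀ j, |δ j| ≤ δstar) :
    |Estar - estimate c Ehat| ≤ gammaConst c * (δstar + B) := by
  refine (abs_estimate_sub_le hc Estar lam a R δ Ehat hE).trans ?_
  rw [gammaConst, sum_mul]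
  refine sum_le_sum fun j _ => ?_
  have hcj : 1 ≤ c j ^ (n + 1) := one_le_pow₀ (hc1 j)
  have h1 : |R j| + |δ j| ≤ c j ^ (n + 1) * (δstar + B) := by
    calc |R j| + |δ j| ≤ B * c j ^ (n + 1) + δstar := add_le_add (hR j) (hδ j)
      _ ≤ B * c j ^ (n + 1) + δstar * c j ^ (n + 1) := by nlinarith
      _ = c j ^ (n + 1) * (δstar + B) := by ring
  calc |richardsonCoeff c j| * (|R j| + |δ j|) ≤ |richardsonCoeff c j| * (c j ^ (n + 1) * (δstar + B)) :=
        mul_le_mul_of_nonneg_left h1 (abs_nonneg _)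
    _ = |richardsonCoeff c j| * c j ^ (n + 1) * (δstar + B) := by ring

/-- **Shot-noise amplification**: `Σ_j γ_j² ≤ (Σ_j |γ_j|)²` — with independent node estimates of
variance `≤ σ²/N_S` each, `Var[Ê^n] = Σ_j γ_j² Var[Ê_j] ≤ (σ²/N_S) Σ_j γ_j² ≤ (σ²/N_S)(Σ_j |γ_j|)²`.
[cite: MohammadipourLi2025, §2 (variance display and the ℓ₁-norm ‖γ‖₁)] -/
theorem sum_sq_richardsonCoeff_le (c : Fin (n + 1) → ℝ) :
    ∑ j, richardsonCoeff c j ^ 2 ≤ (∑ j, |richardsonCoeff c j|) ^ 2 := by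
  calc ∑ j, richardsonCoeff c j ^ 2 = ∑ j, |richardsonCoeff c j| ^ 2 :=
        sum_congr rfl fun j _ => (sq_abs _).symm
    _ ≤ (∑ j, |richardsonCoeff c j|) ^ 2 :=
        sum_sq_le_sq_sum_of_nonneg fun j _ => abs_nonneg _

/-! ### The two-point (linear) case -/

/-- `n = 1`: `γ₀ = c₁/(c₁ − c₀)`, `γ₁ = c₀/(c₀ − c₁)`. [cite: MohammadipourLi2025, §2 (γ_j with n = 1)] -/
theorem richardsonCoeff_fin_two (c : Fin 2 → F) :
    richardsonCoeff c 0 = c 1 / (c 1 - c 0) ∧ richardsonCoeff c 1 = c 0 / (c 0 - c 1) := by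
  have h0 : (univ : Finset (Fin 2)).erase 0 = {1} := by decide
  have h1 : (univ : Finset (Fin 2)).erase 1 = {0} := by decide
  simp only [richardsonCoeff, h0, h1, prod_singleton, and_self]

/-- `n = 1`, the **linear extrapolation** of two noise levels ("ZNE (linear)"):
`Ê¹ = (c₁ Ê₀ − c₀ Ê₁)/(c₁ − c₀)`; with `c₀ = 1` (the bare circuit) and gain `c₁ = G`,
`Ê¹ = (G Ê(λ) − Ê(Gλ))/(G − 1)`. [cite: KimEtAl2023, Fig. 2 ("ZNE (linear)")]
[cite: TemmeBravyiGambetta2017, eq. (RichardsonCoeff) with n = 1] -/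
theorem estimate_fin_two (c Ehat : Fin 2 → F) (h : c 0 ≠ c 1) :
    estimate c Ehat = (c 1 * Ehat 0 - c 0 * Ehat 1) / (c 1 - c 0) := by
  obtain ⟨h0, h1⟩ := richardsonCoeff_fin_two c
  rw [estimate, Fin.sum_univ_two, h0, h1]
  have h10 : c 1 - c 0 ≠ 0 := sub_ne_zero.2 (Ne.symm h)
  have h01 : c 0 - c 1 ≠ 0 := sub_ne_zero.2 h
  field_simp
  ring

/-! ### The closed form as printed in arXiv:1612.02058 (main text) differs by `(−1)^n` -/

/-- The main text of arXiv:1612.02058 prints "`γ_j = ∏_{m≠j} c_m (c_j − c_m)^{-1}`"; factor by factor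
this is `−c_m/(c_m − c_j)`, so the printed product equals `(−1)^n γ_j` (there are `n` factors).
[cite: TemmeBravyiGambetta2017, main text (sentence after eq. (bound), arXiv tex chunk p0003 L33)] -/
theorem prod_printed_eq_neg_one_pow_mul (c : Fin (n + 1) → F) (j : Fin (n + 1)) :
    ∏ m ∈ univ.erase j, c m * (c j - c m)⁻¹ = (-1) ^ n * richardsonCoeff c j := by
  have hfac : ∀ m, c m * (c j - c m)⁻¹ = -1 * (c m / (c m - c j)) := by
    intro m
    rw [← neg_sub (c m) (c j), inv_neg]
    ring
  rw [prod_congr rfl fun m _ => hfac m, prod_mul_distrib, prod_const, card_erase_of_mem (mem_univ j),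
    card_univ, Fintype.card_fin, Nat.add_sub_cancel, richardsonCoeff]

/-- The `n = 1` instance of the discrepancy, nodes `c = (1, 2)`: the printed closed form gives
`(2/(1−2), 1/(2−1)) = (−2, 1)`, which sums to `−1`, not to the required `Σ_j γ_j = 1`; the
Lagrange form gives `(2, −1)`. [cite: TemmeBravyiGambetta2017, eq. (RichardsonEqn) vs. the closed form after eq. (bound)] -/
theorem printed_closed_form_fin_two :
    (∑ j : Fin 2, ∏ m ∈ univ.erase j, (![1, 2] : Fin 2 → ℚ) m * ((![1, 2] : Fin 2 → ℚ) j -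
        (![1, 2] : Fin 2 → ℚ) m)⁻¹) = -1 ∧
      (∑ j : Fin 2, richardsonCoeff (![1, 2] : Fin 2 → ℚ) j) = 1 := by
  have h0 : (univ : Finset (Fin 2)).erase 0 = {1} := by decide
  have h1 : (univ : Finset (Fin 2)).erase 1 = {0} := by decide
  refine ⟨?_, ?_⟩
  · rw [Fin.sum_univ_two, h0, h1, prod_singleton, prod_singleton]
    simp only [Matrix.cons_val_zero, Matrix.cons_val_one]
    norm_num
  · exact sum_richardsonCoeff (by decide)

/-! ### Two noise levels: the linear and the exponential extrapolation of Endo–Benjamin–Li (2018) -/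

/-- The printed two-point LINEAR formula `⟨Z⟩(0) = (r⟨Z⟩(ε₀) − ⟨Z⟩(rε₀))/(r − 1)` IS the `n = 1`
Richardson estimate with amplification factors `(c₀, c₁) = (1, r)`.
[cite: EndoBenjaminLi2018, §XI (p. 9: "we can infer ⟨Z⟩(0) = (r⟨Z⟩(ε₀)−⟨Z⟩(rε₀))/(r−1)")] -/
theorem estimate_pair_one (r : F) (hr : r ≠ 1) (Z0 Zr : F) :
    estimate ![1, r] ![Z0, Zr] = (r * Z0 - Zr) / (r - 1) := by
  rw [estimate_fin_two _ _ (by simpa using hr.symm)]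
  simp

/-- The two-point EXPONENTIAL estimate `⟨Z⟩(ε₀)^{r/(r−1)} · ⟨Z⟩(rε₀)^{1/(1−r)}` (real powers; meaningful
for positive measured values). [cite: EndoBenjaminLi2018, §XI (pp. 10–11, display for ⟨Z⟩(0))] -/
def expEstimate (r Z0 Zr : ℝ) : ℝ :=
  Z0 ^ (r / (r - 1)) * Zr ^ (1 / (1 - r))

/-- **Exactness of the exponential estimate on an exponential response**: if
`⟨Z⟩(ε) = A · e^{−bε}` with `A > 0` (the experimentalist's assumption: exponential in `ε`, tending to
`0` as `ε → ∞` when `b > 0`), then for every `r ≠ 1` the two measured values at `ε₀` and `rε₀` return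
`A = ⟨Z⟩(0)` exactly. Nothing here says any device's response is exponential.
[cite: EndoBenjaminLi2018, §XI (pp. 10–11)] [cite: KimEtAl2023, Fig. 2 ("ZNE (exp)")] -/
theorem expEstimate_exact {A b ε₀ r : ℝ} (hA : 0 < A) (hr : r ≠ 1) :
    expEstimate r (A * Real.exp (-b * ε₀)) (A * Real.exp (-b * (r * ε₀))) = A := by
  have hr1 : r - 1 ≠ 0 := sub_ne_zero.2 hr
  have hr1' : 1 - r ≠ 0 := sub_ne_zero.2 (Ne.symm hr)
  have hpow : r / (r - 1) + 1 / (1 - r) = 1 := by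
    field_simp
    ring
  have harg : -b * ε₀ * (r / (r - 1)) + -b * (r * ε₀) * (1 / (1 - r)) = 0 := by
    field_simp
    ring
  unfold expEstimate
  rw [Real.mul_rpow hA.le (Real.exp_pos _).le, Real.mul_rpow hA.le (Real.exp_pos _).le,
    ← Real.exp_mul, ← Real.exp_mul]
  calc A ^ (r / (r - 1)) * Real.exp (-b * ε₀ * (r / (r - 1))) *
        (A ^ (1 / (1 - r)) * Real.exp (-b * (r * ε₀) * (1 / (1 - r))))
      = (A ^ (r / (r - 1)) * A ^ (1 / (1 - r))) *
          Real.exp (-b * ε₀ * (r / (r - 1)) + -b * (r * ε₀) * (1 / (1 - r))) := by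
        rw [Real.exp_add]; ring
    _ = A := by rw [← Real.rpow_add hA, hpow, Real.rpow_one, harg, Real.exp_zero, mul_one]

/-- The exponential estimate is the LINEAR two-point formula applied to `log ⟨Z⟩`:
`log (Z₀^{r/(r−1)} Z_r^{1/(1−r)}) = (r log Z₀ − log Z_r)/(r − 1)` for positive `Z₀`, `Z_r` —
Richardson extrapolation of the logarithm of the signal.
[cite: EndoBenjaminLi2018, §XI (the two displayed formulas)] -/
theorem log_expEstimate {r Z0 Zr : ℝ} (hr : r ≠ 1) (h0 : 0 < Z0) (h1 : 0 < Zr) :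
    Real.log (expEstimate r Z0 Zr) = (r * Real.log Z0 - Real.log Zr) / (r - 1) := by
  have hr1 : r - 1 ≠ 0 := sub_ne_zero.2 hr
  have hr1' : 1 - r ≠ 0 := sub_ne_zero.2 (Ne.symm hr)
  unfold expEstimate
  rw [Real.log_mul (Real.rpow_pos_of_pos h0 _).ne' (Real.rpow_pos_of_pos h1 _).ne',
    Real.log_rpow h0, Real.log_rpow h1]
  field_simp
  ring

end ZNE

end Literature.Computability.QuantumComplexity
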